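import Mathlib
import HarnessLib

/-!
# A `3′`-image inside `GL₂(𝔽₃)` with one stable line has a second one (Maschke for the Borel of
# `GL₂(𝔽₃)`, element by element) — the finite-group core of LAW L-irr3 (`Irr ⇒ Surj` at `3`)

Cell `pub/bsd-wall` (D-0145 line `route-BirchSwinnertonDyer-CyclotomicUntwist`), seat `bsd-line-cycu-p4`
(width seat 4, gen 6). Helper toward the cruxes K1 `PSRankOneLowerHalfAtThree`
(stmt-BirchSwinnertonDyer-21580) and K2 `PSRankOneUpperHalfAtThree` (stmt-21581), whose rows carry the
binder `Surj W 3`. THEOREMS ONLY (no definition, no named fact, no `sorry`); pure finite group theory in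
`GL₂(𝔽₃)`; BSD is not proved by this file and no crux is. First of three files of LAW L-irr3: on every
row of `E/ℚ` where `E[3]|G_{ℚ₃}` has exactly ONE stable line (the whole cyclic wild cell at `3`, every
curve with `Δ_min` outside the `3`-adic cube class) `E[3]` irreducible ⟹ `ρ̄_{E,3}` onto.

The mechanism here: let `f : Γ → GL₂(𝔽₃)` be a homomorphism whose image stabilises the line of
`v ≠ 0` and contains NO element of order divisible by `3`. Every element of the stabiliser of a line
(a Borel subgroup, order `12`) has order `1, 2, 3` or `6` (`pow_six_eq_one_of_eigen`), so every `f γ`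
is an involution, the image is abelian, and either it is scalar (every line is stable) or some
non-scalar involution `f γ₀` splits `𝔽₃² = L⁺ ⊕ L⁻` into two eigenlines, one of them the line of `v`,
the other stable under everything commuting with `f γ₀` — a SECOND common eigenline
(**`exists_second_common_eigenvector`**). Contrapositively: a reducible but NON-split plane
representation over `𝔽₃` has an element of order divisible by `3` in its image. The `2 × 2` linear
algebra over `𝔽₃` is discharged by `decide` on matrix entries (§1), then repackaged for
`GL (Fin 2) (ZMod 3)` (§2).

References: J.-P. Serre, Invent. Math. 15 (1972) §2.4 (Borel subgroups, Prop. 15) [Serre1972];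
H. Maschke / any algebra text (complete reducibility in coprime characteristic).
-/

-- single-conjunct summit: `Summit.BirchSwinnertonDyer.BirchSwinnertonDyer.…` repeats the name by design
set_option linter.dupNamespace false
set_option autoImplicit false

namespace Summit.BirchSwinnertonDyer.BirchSwinnertonDyer.Theorems.PSIrrSurjThree

open Matrix

/-! ### §1 The `2 × 2` linear algebra over `𝔽₃`, on entries (kernel decision) -/

section Entries

/-- An invertible `M = (a b; c d)` over `𝔽₃` with an eigenvector `(x, y) ≠ 0` satisfies `M⁶ = 1`
(the stabiliser of a line in `GL₂(𝔽₃)` has exponent `6`). [cite: Serre1972, §2.4] -/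
theorem entries_pow_six_eq_one : ∀ a b c d x y e : ZMod 3, a * d - b * c ≠ 0 → (x ≠ 0 ∨ y ≠ 0) →
    a * x + b * y = e * x → c * x + d * y = e * y →
    (!![a, b; c, d] : Matrix (Fin 2) (Fin 2) (ZMod 3)) ^ 6 = 1 := by
  decide

/-- A non-scalar involution `M` over `𝔽₃` with an eigenvector `(x, y) ≠ 0` has a second eigenvector
`(x', y')` off the line of `(x, y)`. [folklore] -/
theorem entries_exists_second_eigenvector : ∀ a b c d : ZMod 3,
    (!![a, b; c, d] : Matrix (Fin 2) (Fin 2) (ZMod 3)) ^ 2 = 1 →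
    (!![a, b; c, d] : Matrix (Fin 2) (Fin 2) (ZMod 3)) ≠ 1 →
    (!![a, b; c, d] : Matrix (Fin 2) (Fin 2) (ZMod 3)) ≠ -1 →
    ∀ x y e : ZMod 3, (x ≠ 0 ∨ y ≠ 0) → a * x + b * y = e * x → c * x + d * y = e * y →
    ∃ x' y' μ : ZMod 3, (∀ k : ZMod 3, ¬ (x' = k * x ∧ y' = k * y)) ∧
      a * x' + b * y' = μ * x' ∧ c * x' + d * y' = μ * y' := by
  decide

/-- Two eigenvectors of a non-scalar involution over `𝔽₃` for the SAME eigenvalue, the first non-zero,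
are dependent. [folklore] -/
theorem entries_det_eq_zero_of_eigen_eigen : ∀ a b c d : ZMod 3,
    (!![a, b; c, d] : Matrix (Fin 2) (Fin 2) (ZMod 3)) ^ 2 = 1 →
    (!![a, b; c, d] : Matrix (Fin 2) (Fin 2) (ZMod 3)) ≠ 1 →
    (!![a, b; c, d] : Matrix (Fin 2) (Fin 2) (ZMod 3)) ≠ -1 →
    ∀ x' y' μ s t : ZMod 3, (x' ≠ 0 ∨ y' ≠ 0) → a * x' + b * y' = μ * x' → c * x' + d * y' = μ * y' →
    a * s + b * t = μ * s → c * s + d * t = μ * t → x' * t - y' * s = 0 := by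
  decide

/-- A vector dependent on a non-zero vector of `𝔽₃²` is a multiple of it. [folklore] -/
theorem entries_exists_eq_mul_of_det_eq_zero : ∀ x' y' s t : ZMod 3, (x' ≠ 0 ∨ y' ≠ 0) →
    x' * t - y' * s = 0 → ∃ k : ZMod 3, s = k * x' ∧ t = k * y' := by
  decide

/-- Off any line of `𝔽₃²` there is a non-zero vector. [folklore] -/
theorem entries_exists_off_line : ∀ x y : ZMod 3, ∃ x' y' : ZMod 3, (x' ≠ 0 ∨ y' ≠ 0) ∧
    ∀ k : ZMod 3, ¬ (x' = k * x ∧ y' = k * y) := by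
  decide

end Entries

/-! ### §2 Repackaging for `GL (Fin 2) (ZMod 3)` acting on `Fin 2 → ZMod 3` -/

section GLTwo

/-- `M *ᵥ v = c • v` on entries. [folklore] -/
theorem mulVec_eq_smul_iff (M : Matrix (Fin 2) (Fin 2) (ZMod 3)) (v : Fin 2 → ZMod 3) (c : ZMod 3) :
    M *ᵥ v = c • v ↔ M 0 0 * v 0 + M 0 1 * v 1 = c * v 0 ∧ M 1 0 * v 0 + M 1 1 * v 1 = c * v 1 := by
  simp [funext_iff, Fin.forall_fin_two]

/-- `v ≠ 0` on entries. [folklore] -/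
theorem ne_zero_iff (v : Fin 2 → ZMod 3) : v ≠ 0 ↔ (v 0 ≠ 0 ∨ v 1 ≠ 0) := by
  rw [Ne, funext_iff, Fin.forall_fin_two]
  simp only [Pi.zero_apply]
  tauto

/-- `w = k • v` on entries. [folklore] -/
theorem eq_smul_iff (w v : Fin 2 → ZMod 3) (k : ZMod 3) : w = k • v ↔ w 0 = k * v 0 ∧ w 1 = k * v 1 := by
  simp [funext_iff, Fin.forall_fin_two]

/-- **An element of `GL₂(𝔽₃)` with an eigenvector has `g⁶ = 1`** (it lies in a Borel subgroup, of order
`12` and exponent `6`). [cite: Serre1972, §2.4] -/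
theorem pow_six_eq_one_of_eigen (g : GL (Fin 2) (ZMod 3)) {v : Fin 2 → ZMod 3} (hv : v ≠ 0) {c : ZMod 3}
    (h : (g : Matrix (Fin 2) (Fin 2) (ZMod 3)) *ᵥ v = c • v) : g ^ 6 = 1 := by
  set M : Matrix (Fin 2) (Fin 2) (ZMod 3) := (g : Matrix (Fin 2) (Fin 2) (ZMod 3)) with hM
  have hdet : M.det ≠ 0 := by
    rw [hM, ← Matrix.GeneralLinearGroup.val_det_apply]
    exact (Matrix.GeneralLinearGroup.det g).ne_zero
  rw [Matrix.eta_fin_two M, Matrix.det_fin_two_of] at hdet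
  rw [mulVec_eq_smul_iff] at h
  have h6 := entries_pow_six_eq_one (M 0 0) (M 0 1) (M 1 0) (M 1 1) (v 0) (v 1) c hdet
    ((ne_zero_iff v).mp hv) h.1 h.2
  rw [← Matrix.eta_fin_two M] at h6
  exact Units.ext (by rw [Units.val_pow_eq_pow_val, Units.val_one]; exact h6)

/-- **A non-scalar involution of `GL₂(𝔽₃)` with an eigenvector `v ≠ 0` has a second eigenline**, off
the line of `v`, and that eigenline is the full eigenspace of its eigenvalue. [folklore] -/
theorem exists_other_eigenline (g : GL (Fin 2) (ZMod 3)) (h2 : g ^ 2 = 1) (h1 : g ≠ 1) (hm1 : g ≠ -1)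
    {v : Fin 2 → ZMod 3} (hv : v ≠ 0) {c : ZMod 3} (h : (g : Matrix (Fin 2) (Fin 2) (ZMod 3)) *ᵥ v = c • v) :
    ∃ w : Fin 2 → ZMod 3, (∀ k : ZMod 3, w ≠ k • v) ∧ ∃ μ : ZMod 3,
      (g : Matrix (Fin 2) (Fin 2) (ZMod 3)) *ᵥ w = μ • w ∧
      ∀ u : Fin 2 → ZMod 3, (g : Matrix (Fin 2) (Fin 2) (ZMod 3)) *ᵥ u = μ • u → ∃ k : ZMod 3, u = k • w := by
  set M : Matrix (Fin 2) (Fin 2) (ZMod 3) := (g : Matrix (Fin 2) (Fin 2) (ZMod 3)) with hM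
  have hM2 : M ^ 2 = 1 := by
    have := congrArg (fun x : GL (Fin 2) (ZMod 3) ↦ (x : Matrix (Fin 2) (Fin 2) (ZMod 3))) h2
    simpa only [Units.val_pow_eq_pow_val, Units.val_one] using this
  have hM1 : M ≠ 1 := fun hM1 ↦ h1 (Units.ext (by rw [Units.val_one]; exact hM1))
  have hMm1 : M ≠ -1 := fun hMm1 ↦ hm1 (Units.ext (by rw [Units.val_neg, Units.val_one]; exact hMm1))
  rw [Matrix.eta_fin_two M] at hM2 hM1 hMm1
  rw [mulVec_eq_smul_iff] at h
  obtain ⟨x', y', μ, hk, h₁, h₂⟩ := entries_exists_second_eigenvector (M 0 0) (M 0 1) (M 1 0) (M 1 1)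
    hM2 hM1 hMm1 (v 0) (v 1) c ((ne_zero_iff v).mp hv) h.1 h.2
  have hw0 : x' ≠ 0 ∨ y' ≠ 0 := by
    by_contra h0
    push Not at h0
    exact hk 0 ⟨by rw [h0.1, zero_mul], by rw [h0.2, zero_mul]⟩
  refine ⟨![x', y'], fun k hk' ↦ hk k ?_, μ, ?_, fun u hu ↦ ?_⟩
  · rw [eq_smul_iff] at hk'
    simpa using hk'
  · rw [mulVec_eq_smul_iff]
    simpa using And.intro h₁ h₂
  · rw [mulVec_eq_smul_iff] at hu
    have hdet := entries_det_eq_zero_of_eigen_eigen (M 0 0) (M 0 1) (M 1 0) (M 1 1) hM2 hM1 hMm1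
      x' y' μ (u 0) (u 1) hw0 h₁ h₂ hu.1 hu.2
    obtain ⟨k, hk₁, hk₂⟩ := entries_exists_eq_mul_of_det_eq_zero x' y' (u 0) (u 1) hw0 hdet
    exact ⟨k, by rw [eq_smul_iff]; simpa using And.intro hk₁ hk₂⟩

/-- Off any line of `𝔽₃²` there is a non-zero vector. [folklore] -/
theorem exists_off_line (v : Fin 2 → ZMod 3) : ∃ w : Fin 2 → ZMod 3, w ≠ 0 ∧ ∀ k : ZMod 3, w ≠ k • v := by
  obtain ⟨x', y', h0, hk⟩ := entries_exists_off_line (v 0) (v 1)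
  refine ⟨![x', y'], (ne_zero_iff _).mpr (by simpa using h0), fun k hk' ↦ hk k ?_⟩
  rw [eq_smul_iff] at hk'
  simpa using hk'

/-- **The core of LAW L-irr3.** Let `f : Γ → GL₂(𝔽₃)` be a homomorphism such that NO `f γ` has order
divisible by `3`, and let `v ≠ 0` be a common eigenvector of the image (a stable line). Then there is a
SECOND common eigenvector `w ≠ 0` off the line of `v`: every `f γ` lies in the Borel of `v`, has order
prime to `3`, hence is an involution (`pow_six_eq_one_of_eigen`); the image is then abelian
(two involutions with involutive product commute); if it is scalar every line is stable (`exists_off_line`), otherwise a non-scalar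
involution `f γ₀` has a second eigenline (`exists_other_eigenline`), which is the full eigenspace of its
eigenvalue and is therefore stable under everything commuting with `f γ₀`. Contrapositive: a plane
representation over `𝔽₃` with EXACTLY one stable line has an element of order divisible by `3` in its
image. [cite: Serre1972, §2.4 Prop. 15] -/
theorem exists_second_common_eigenvector {Γ : Type*} [Group Γ] (f : Γ →* GL (Fin 2) (ZMod 3))
    (h3 : ∀ γ : Γ, ¬ 3 ∣ orderOf (f γ)) {v : Fin 2 → ZMod 3} (hv : v ≠ 0)
    (hfv : ∀ γ : Γ, ∃ c : ZMod 3, (f γ : Matrix (Fin 2) (Fin 2) (ZMod 3)) *ᵥ v = c • v) :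
    ∃ w : Fin 2 → ZMod 3, w ≠ 0 ∧ (∀ k : ZMod 3, w ≠ k • v) ∧
      ∀ γ : Γ, ∃ c : ZMod 3, (f γ : Matrix (Fin 2) (Fin 2) (ZMod 3)) *ᵥ w = c • w := by
  -- every `f γ` is an involution
  have hsq : ∀ γ : Γ, f γ ^ 2 = 1 := by
    intro γ
    obtain ⟨c, hc⟩ := hfv γ
    have h6 : f γ ^ 6 = 1 := pow_six_eq_one_of_eigen (f γ) hv hc
    have hord : orderOf (f γ) ∣ 6 := orderOf_dvd_of_pow_eq_one h6
    have hle : orderOf (f γ) ≤ 6 := Nat.le_of_dvd (by norm_num) hord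
    have h3γ := h3 γ
    have h2 : orderOf (f γ) ∣ 2 := by
      interval_cases hγ : orderOf (f γ) <;> omega
    exact orderOf_dvd_iff_pow_eq_one.mp h2
  -- the image is abelian
  have hcomm : ∀ γ δ : Γ, f γ * f δ = f δ * f γ := by
    intro γ δ
    -- two involutions whose product is an involution commute
    -- (cf. `Literature.NumberTheory.Automorphic.mul_comm_of_sq_eq_one`, not imported here)
    have hinv : ∀ x : GL (Fin 2) (ZMod 3), x ^ 2 = 1 → x⁻¹ = x := fun x hx ↦
      inv_eq_of_mul_eq_one_right (by rw [← sq]; exact hx)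
    have h := hinv _ (show (f γ * f δ) ^ 2 = 1 by rw [← map_mul]; exact hsq (γ * δ))
    rw [_root_.mul_inv_rev, hinv _ (hsq γ), hinv _ (hsq δ)] at h
    exact h.symm
  by_cases hscal : ∀ γ : Γ, f γ = 1 ∨ f γ = -1
  · -- scalar image: every line is stable
    obtain ⟨w, hw0, hwv⟩ := exists_off_line v
    refine ⟨w, hw0, hwv, fun γ ↦ ?_⟩
    rcases hscal γ with h | h
    · exact ⟨1, by rw [h, Units.val_one, Matrix.one_mulVec, one_smul]⟩
    · exact ⟨-1, by rw [h, Units.val_neg, Units.val_one, Matrix.neg_mulVec, Matrix.one_mulVec, neg_one_smul]⟩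
  · -- a non-scalar involution `f γ₀`: its other eigenline is stable under the (abelian) image
    push Not at hscal
    obtain ⟨γ₀, h1, hm1⟩ := hscal
    obtain ⟨c₀, hc₀⟩ := hfv γ₀
    obtain ⟨w, hwv, μ, hμ, huniq⟩ := exists_other_eigenline (f γ₀) (hsq γ₀) h1 hm1 hv hc₀
    have hw0 : w ≠ 0 := fun h ↦ hwv 0 (by rw [h, zero_smul])
    refine ⟨w, hw0, hwv, fun γ ↦ huniq _ ?_⟩
    rw [Matrix.mulVec_mulVec, ← Units.val_mul, hcomm γ₀ γ, Units.val_mul, ← Matrix.mulVec_mulVec, hμ,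
      Matrix.mulVec_smul]

end GLTwo

end Summit.BirchSwinnertonDyer.BirchSwinnertonDyer.Theorems.PSIrrSurjThree
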